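import Literature.NumberTheory.Automorphic.ArchEndoscopicChartMeasures     -- ★ (T-MEAS) p849670 (LH2-p04 (g3)): `chartOrbH L νH S fH c`, `chartOrbH_congr`, `chartOrbH_zero`; ★ atlas `endoTorus`
import Literature.NumberTheory.Automorphic.ArchCartanWallExtension        -- ★ (D2-P3a): `bzExtend`, `stableSum`, the transported symmetries
import Literature.NumberTheory.Rogawski1990.ArchBouazizSpace               -- ★ (D2-pack): `ArchBouazizSpaceH`, `ArchBzPeriodic`, `ArchBzWeyl`
import HarnessLib

/-!
# `stOrbFamH νH fH` — THE STABLE ORBITAL FAMILY of a function on `H_∞ = U(Φ₂)(L ⊗ ℝ) × U(Φ₁)(L ⊗ ℝ)`, read on every Cartan chart, normalised by `R_T`, extended across the real walls;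
# its periodicity (P) UNCONDITIONALLY and its stable Weyl symmetry (W) from the realised-reflection invariance of the chart functional
# (Shelstad 1979 §4 pp. 22–24; Bouaziz 1994 §6.2 p. 591; Rogawski 1990 §4.1 (4.1.1), §8.2)

Topic `NumberTheory/Rogawski1990`; namespace `Literature.NumberTheory.Rogawski1990`.  Definitions WITH BODIES and theorems only (no instance, no notation, no axiom, no named
fact, no `sorry`).  Cell `pub/hodgecm-mathlib`, line LH3 (closer stub `stub_N9`, crux H413 = `stmt-HodgeConjecture-24833`); organ **(D2-P3) «PART 3»** of the LH3 direct road
(PACK-SPEC v1 §2 `stOrbFamH`; SEAM RULING 2026-09-02T05:53:17Z: LITERAL on `RegS`, `extendFrom` on the real walls).  Author LH3-p01 (g3).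

THE FAMILY.  For a Haar-type measure `νH` on `H_∞` and `fH : H_∞ → ℂ`:
  `stOrbFamH L νH fH S := bzExtend S (fun c => archRH S c * stableSum S (chartOrbH L νH S fH) c)`
— on the regular set `RegS S` LITERALLY `R_S(c) · Σ_{T ⊆ univ∖S} chartOrbH νH S fH (flipSet T c)` (Shelstad's `Ψ^{T,1}_f = R_T · Φ^{T,1}_f`, the stable sum over the flips of the compact
places = the classes of `H_∞` in the stable class of the chart point, ★ `injective_conjClassesMk_flip`; ★ `chartOrbH` = the chart orbital functional of (T-MEAS) with its canonical
box-mass normalisation); on the real walls `x_w = 0` the extension from `RegS S` (Harish-Chandra's `F_f^A(1)`, Bouaziz (I₂) — the letter's clause); `0` on the imaginary walls.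
This is the map `fH ↦ Ψfam` whose image the letter O-L3′ (Bouaziz's Thm. 6.2.1 (i)) identifies with ★ `ArchBouazizSpaceH jcH`.

WHAT IS PROVED (no orbital-integral analysis — symmetries only).
* §1 atlas periodicity: `endoBlock_add_angleShift`, `endoCircle_add_angleShift`, **`endoTorus_add_angleShift (h : w ∉ S ∨ i ≠ 0) : endoTorus L S (c + angleShift w i k) = endoTorus L S c`**
  (angle slots are `2π`-periodic in the chart; the split slot `x` is not), hence `chartOrbH_add_angleShift` (★ `chartOrbH_congr`).
* §2 `stOrbFamH`, `stOrbFamH_of_mem_regS` (the literal reading O-READ ∕ (CUR) consume), `stOrbFamH_zero_fun` on `RegS`.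
* §3 **(P) `archBzPeriodic_stOrbFamH : ArchBzPeriodic (stOrbFamH L νH fH)`** — UNCONDITIONAL (★ `bzExtend_normStableSum_add_angleShift`).
* §4 (W): the flip half **`stOrbFamH_flipAt_mul_archRH`** UNCONDITIONAL (★ `bzExtend_normStableSum_flipAt_mul_archRH`: the stable sum is flip-invariant by itself); the real half
  `stOrbFamH_negXAt` from the REALISED-reflection invariance of the chart functional on `RegS S` (hypothesis `hneg`: «`chartOrbH νH S fH (negXAt w c) = chartOrbH νH S fH c` for
  `w ∈ S`, `c ∈ RegS S`» — conjugation by the Weyl element of `U(Φ₂)_w` normalising the split torus; (T-MEAS) ED. 2 `chartOrbH_negXAt`, LH2-p04), and the packaged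
  **`archBzWeyl_stOrbFamH (hneg) : ArchBzWeyl (stOrbFamH L νH fH)`**.
NOT HERE: (I₁)+(I₂), (I₃), (I₄) for `stOrbFamH` of a test function — (I₄) is the support organ, (I₁) at order 0 on the elliptic chart is ★ (CONT-H-ell), the rest is the LETTER O-L3′.
HONEST LABEL: HC_CM is proved only modulo the 7 printed citations (2 remaining: hLiu418 = stmt-HodgeConjecture-24832, h413 = stmt-HodgeConjecture-24833) until rung 0 closes; this
file defines the map of a LETTER and proves only its symmetries.

## References
* [Shelstad1979] D. Shelstad, *Characters and inner forms of a quasi-split group over ℝ*, Compositio Math. 39 (1979), §4 pp. 22–24 (`Φ^{T,1}_f`, `Ψ^T_f = R_T Φ`, (I)–(II)).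
* [Bouaziz1994IntegralesOrbitales] A. Bouaziz, *Intégrales orbitales sur les groupes de Lie réductifs*, Ann. Sci. ÉNS 27 (1994) 573–609, §6.2 p. 591 (`ψ^{st}`, `I^st`), Thm. 6.2.1 (i)
  p. 592.
* [Rogawski1990] J. D. Rogawski, *Automorphic Representations of Unitary Groups in Three Variables*, Ann. of Math. Stud. 123 (1990), §4.1 (4.1.1) p. 39 (`Φ^st`), §3.6 p. 31,
  §8.2 p. 122 (the charts).
-/

set_option autoImplicit false

noncomputable section

open MeasureTheory NumberField NumberField.InfinitePlace Complex Set Function Real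
open Literature.NumberTheory.Automorphic Literature.NumberTheory.Automorphic.UnitaryGroup Literature.NumberTheory.Automorphic.ArchCartan
open scoped Classical

namespace Literature.NumberTheory.Rogawski1990

/-! ## §1 The chart is `2π`-periodic in its angle slots -/

section Periodic

variable (L : Type) [Field L]

/-- The hyperbolic block reads its phase through `e^{iθ}`: equal phases on the circle give equal blocks. [cite: Rogawski1990, §3.6 p. 31] -/
theorem hypBlockGL_eq_of_circleExp_eq (x : ℝ) {θ θ' : ℝ} (h : Circle.exp θ = Circle.exp θ') : hypBlockGL x θ = hypBlockGL x θ' := by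
  have h' : Complex.exp ((θ : ℂ) * I) = Complex.exp ((θ' : ℂ) * I) := by
    have h1 := congrArg (fun z : Circle => (z : ℂ)) h
    simpa only [Circle.coe_exp] using h1
  apply Units.ext
  rw [coe_hypBlockGL, coe_hypBlockGL]
  simp only [Complex.exp_add, h']

variable {L} in
/-- **The `U(Φ₂)_w`-block is `2π`-periodic in the angle slots** (`w ∉ S`: both slots `0, 2` are angles; `w ∈ S`: slot `2` is the phase, slot `0 = x` is untouched because `i ≠ 0`).
[cite: Rogawski1990, §8.2 p. 122; §3.6 p. 31] -/
theorem endoBlock_add_angleShift (S : Finset {w : InfinitePlace L // IsComplex w}) (c : {w : InfinitePlace L // IsComplex w} → Fin 3 → ℝ)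
    {w : {w : InfinitePlace L // IsComplex w}} {i : Fin 3} (h : w ∉ S ∨ i ≠ 0) (k : ℤ) (w' : {w : InfinitePlace L // IsComplex w}) :
    endoBlock L S (c + angleShift w i k) w' = endoBlock L S c w' := by
  by_cases hw' : w' ∈ S
  · -- split place
    have h0 : (c + angleShift w i k) w' 0 = c w' 0 := by
      rw [Pi.add_apply, Pi.add_apply]
      by_cases hww : w' = w
      · subst hww
        have hi : i ≠ 0 := h.resolve_left (fun hn => hn hw')
        rw [angleShift_apply_self_of_ne w' hi.symm, add_zero]
      · rw [angleShift_apply_of_ne hww, Pi.zero_apply, add_zero]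
    apply Subtype.ext
    simp only [endoBlock, if_pos hw']
    rw [h0]
    exact hypBlockGL_eq_of_circleExp_eq (c w' 0) (circleExp_add_angleShift c w i k w' 2)
  · -- compact place: both slots through `Circle.exp`
    apply Subtype.ext
    simp only [endoBlock, if_neg hw', circleExp_add_angleShift]

variable {L} in
/-- The `U(Φ₁)_w`-entry is `2π`-periodic. [cite: Rogawski1990, §4.9 p. 54] -/
theorem endoCircle_add_angleShift (c : {w : InfinitePlace L // IsComplex w} → Fin 3 → ℝ) (w : {w : InfinitePlace L // IsComplex w}) (i : Fin 3) (k : ℤ)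
    (w' : {w : InfinitePlace L // IsComplex w}) : endoCircle L (c + angleShift w i k) w' = endoCircle L c w' := by
  apply Subtype.ext
  simp only [endoCircle, circleExp_add_angleShift]

end Periodic

section Family

variable (L : Type) [Field L] [NumberField L] [IsCMField L]

/-- **THE CHART IS `2π`-PERIODIC IN ITS ANGLE SLOTS**: `endoTorus L S (c + 2πk·e_{(w,i)}) = endoTorus L S c` whenever `(w, i)` is an angle slot of the chart `S` (`w ∉ S ∨ i ≠ 0`).
[cite: Rogawski1990, §8.2 p. 122] [cite: Shelstad1979, §4 p. 22] -/
theorem endoTorus_add_angleShift (S : Finset {w : InfinitePlace L // IsComplex w}) (c : {w : InfinitePlace L // IsComplex w} → Fin 3 → ℝ)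
    {w : {w : InfinitePlace L // IsComplex w}} {i : Fin 3} (h : w ∉ S ∨ i ≠ 0) (k : ℤ) :
    endoTorus L S (c + angleShift w i k) = endoTorus L S c := by
  have hB : endoBlock L S (c + angleShift w i k) = endoBlock L S c := funext fun w' => endoBlock_add_angleShift S c h k w'
  have hC : endoCircle L (c + angleShift w i k) = endoCircle L c := funext fun w' => endoCircle_add_angleShift c w i k w'
  unfold endoTorus
  rw [hB, hC]

variable
  [MeasurableSpace (↥(arch (↥(maximalRealSubfield L)) L (IsCMField.complexConj L) 2 (Matrix.of fun i j : Fin 2 => if i.val + j.val + 1 = 2 then (1 : L) else 0)) ×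
      ↥(arch (↥(maximalRealSubfield L)) L (IsCMField.complexConj L) 1 (Matrix.of fun i j : Fin 1 => if i.val + j.val + 1 = 1 then (1 : L) else 0)))]
  [BorelSpace (↥(arch (↥(maximalRealSubfield L)) L (IsCMField.complexConj L) 2 (Matrix.of fun i j : Fin 2 => if i.val + j.val + 1 = 2 then (1 : L) else 0)) ×
      ↥(arch (↥(maximalRealSubfield L)) L (IsCMField.complexConj L) 1 (Matrix.of fun i j : Fin 1 => if i.val + j.val + 1 = 1 then (1 : L) else 0)))]
  (νH : Measure (↥(arch (↥(maximalRealSubfield L)) L (IsCMField.complexConj L) 2 (Matrix.of fun i j : Fin 2 => if i.val + j.val + 1 = 2 then (1 : L) else 0)) ×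
      ↥(arch (↥(maximalRealSubfield L)) L (IsCMField.complexConj L) 1 (Matrix.of fun i j : Fin 1 => if i.val + j.val + 1 = 1 then (1 : L) else 0))))
  [IsFiniteMeasureOnCompacts νH] [νH.IsMulRightInvariant]

/-- **The chart orbital functional is `2π`-periodic in the angle slots** (★ `chartOrbH_congr` over `endoTorus_add_angleShift`) — for EVERY `c`, any `fH`.
[cite: Rogawski1990, §8.2 p. 122] -/
theorem chartOrbH_add_angleShift (S : Finset {w : InfinitePlace L // IsComplex w})
    (fH : ↥(arch (↥(maximalRealSubfield L)) L (IsCMField.complexConj L) 2 (Matrix.of fun i j : Fin 2 => if i.val + j.val + 1 = 2 then (1 : L) else 0)) ×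
      ↥(arch (↥(maximalRealSubfield L)) L (IsCMField.complexConj L) 1 (Matrix.of fun i j : Fin 1 => if i.val + j.val + 1 = 1 then (1 : L) else 0)) → ℂ)
    (c : {w : InfinitePlace L // IsComplex w} → Fin 3 → ℝ) {w : {w : InfinitePlace L // IsComplex w}} {i : Fin 3} (h : w ∉ S ∨ i ≠ 0) (k : ℤ) :
    chartOrbH L νH S fH (c + angleShift w i k) = chartOrbH L νH S fH c :=
  chartOrbH_congr L νH S fH (endoTorus_add_angleShift L S c h k)

/-! ## §2 The stable orbital family `stOrbFamH` -/

/-- **`stOrbFamH L νH fH S c` — the stable orbital family of `fH` on the Cartan chart `S`** (PACK-SPEC §2; Shelstad's `Ψ^{T,1}_f`): on the regular set LITERALLY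
`R_S(c) · Σ_{T ⊆ univ ∖ S} chartOrbH νH S fH (flipSet T c)` — `R_T` times the sum of the chart orbital functional over the `2^{#compact places}` flips (the classes in the stable
class of the chart point); on the real walls the extension from `RegS S`; `0` on the imaginary walls (★ `bzExtend`). [cite: Shelstad1979, §4 p. 22]
[cite: Bouaziz1994IntegralesOrbitales, §6.2 p. 591] [cite: Rogawski1990, §4.1 (4.1.1) p. 39] -/
def stOrbFamH
    (fH : ↥(arch (↥(maximalRealSubfield L)) L (IsCMField.complexConj L) 2 (Matrix.of fun i j : Fin 2 => if i.val + j.val + 1 = 2 then (1 : L) else 0)) ×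
      ↥(arch (↥(maximalRealSubfield L)) L (IsCMField.complexConj L) 1 (Matrix.of fun i j : Fin 1 => if i.val + j.val + 1 = 1 then (1 : L) else 0)) → ℂ)
    (S : Finset {w : InfinitePlace L // IsComplex w}) : ({w : InfinitePlace L // IsComplex w} → Fin 3 → ℝ) → ℂ :=
  bzExtend S (fun c => archRH S c * stableSum S (chartOrbH L νH S fH) c)

/-- Unfolding of `stOrbFamH`. [cite: Shelstad1979, §4 p. 22] -/
theorem stOrbFamH_def
    (fH : ↥(arch (↥(maximalRealSubfield L)) L (IsCMField.complexConj L) 2 (Matrix.of fun i j : Fin 2 => if i.val + j.val + 1 = 2 then (1 : L) else 0)) ×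
      ↥(arch (↥(maximalRealSubfield L)) L (IsCMField.complexConj L) 1 (Matrix.of fun i j : Fin 1 => if i.val + j.val + 1 = 1 then (1 : L) else 0)) → ℂ)
    (S : Finset {w : InfinitePlace L // IsComplex w}) :
    stOrbFamH L νH fH S = bzExtend S (fun c => archRH S c * stableSum S (chartOrbH L νH S fH) c) :=
  rfl

/-- **THE LITERAL READING ON THE REGULAR SET** (what O-READ ∕ (CUR) consume): for `c ∈ RegS S`,
`stOrbFamH νH fH S c = R_S(c) · Σ_{T ⊆ univ ∖ S} chartOrbH νH S fH (flipSet T c)`. [cite: Shelstad1979, §4 p. 22] [cite: Rogawski1990, §4.1 (4.1.1) p. 39] -/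
theorem stOrbFamH_of_mem_regS
    (fH : ↥(arch (↥(maximalRealSubfield L)) L (IsCMField.complexConj L) 2 (Matrix.of fun i j : Fin 2 => if i.val + j.val + 1 = 2 then (1 : L) else 0)) ×
      ↥(arch (↥(maximalRealSubfield L)) L (IsCMField.complexConj L) 1 (Matrix.of fun i j : Fin 1 => if i.val + j.val + 1 = 1 then (1 : L) else 0)) → ℂ)
    (S : Finset {w : InfinitePlace L // IsComplex w}) {c : {w : InfinitePlace L // IsComplex w} → Fin 3 → ℝ} (hc : c ∈ RegS S) :
    stOrbFamH L νH fH S c = archRH S c * ∑ T ∈ (Finset.univ \ S).powerset, chartOrbH L νH S fH (flipSet T c) :=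
  bzExtend_of_mem_regS S _ hc

/-- Off `InRegS S` (imaginary walls) the family is `0`. [cite: Bouaziz1994IntegralesOrbitales, §6.2 p. 591] -/
theorem stOrbFamH_of_not_mem_inRegS
    (fH : ↥(arch (↥(maximalRealSubfield L)) L (IsCMField.complexConj L) 2 (Matrix.of fun i j : Fin 2 => if i.val + j.val + 1 = 2 then (1 : L) else 0)) ×
      ↥(arch (↥(maximalRealSubfield L)) L (IsCMField.complexConj L) 1 (Matrix.of fun i j : Fin 1 => if i.val + j.val + 1 = 1 then (1 : L) else 0)) → ℂ)
    (S : Finset {w : InfinitePlace L // IsComplex w}) {c : {w : InfinitePlace L // IsComplex w} → Fin 3 → ℝ} (hc : c ∉ InRegS S) :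
    stOrbFamH L νH fH S c = 0 :=
  bzExtend_of_not_mem_inRegS S _ hc

/-- The family of the zero function vanishes on the regular set (★ `chartOrbH_zero`). [cite: Rogawski1990, §4.1 (4.1.1) p. 39] -/
theorem stOrbFamH_zero_of_mem_regS (S : Finset {w : InfinitePlace L // IsComplex w}) {c : {w : InfinitePlace L // IsComplex w} → Fin 3 → ℝ} (hc : c ∈ RegS S) :
    stOrbFamH L νH 0 S c = 0 := by
  rw [stOrbFamH_of_mem_regS L νH 0 S hc]
  simp only [chartOrbH_zero, Finset.sum_const_zero, mul_zero]

/-! ## §3 (P): the family is periodic in every angle slot — unconditionally -/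

/-- **(P) FOR THE STABLE ORBITAL FAMILY**: `ArchBzPeriodic (stOrbFamH L νH fH)` for EVERY `fH` and every measure `νH` — the chart functional reads `c` through the chart point
(`chartOrbH_add_angleShift`), and ★ `bzExtend_normStableSum_add_angleShift` transports periodicity through `R_S`, the stable sum and the wall extension.
[cite: Shelstad1979, §4 p. 22] [cite: Bouaziz1994IntegralesOrbitales, §3.1 p. 579] -/
theorem archBzPeriodic_stOrbFamH
    (fH : ↥(arch (↥(maximalRealSubfield L)) L (IsCMField.complexConj L) 2 (Matrix.of fun i j : Fin 2 => if i.val + j.val + 1 = 2 then (1 : L) else 0)) ×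
      ↥(arch (↥(maximalRealSubfield L)) L (IsCMField.complexConj L) 1 (Matrix.of fun i j : Fin 1 => if i.val + j.val + 1 = 1 then (1 : L) else 0)) → ℂ) :
    ArchBzPeriodic (stOrbFamH L νH fH) := by
  intro S c w i k h
  exact bzExtend_normStableSum_add_angleShift S (fun c _ w i k h => chartOrbH_add_angleShift L νH S fH c h k) h k c

/-! ## §4 (W): the stable Weyl symmetry -/

/-- **(W), FLIP HALF — UNCONDITIONAL**: at a compact place `w ∉ S`, `stOrbFamH S (flipAt w c) · R_S(c) = R_S(flipAt w c) · stOrbFamH S c` for EVERY `c` (the stable sum is flip-invariant,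
★ `stableSum_flipAt`; the rest is ★ `bzExtend_flipAt_mul_archRH`'s trichotomy). [cite: Shelstad1979, §4 p. 23] [cite: Rogawski1990, §4.1 p. 40] -/
theorem stOrbFamH_flipAt_mul_archRH
    (fH : ↥(arch (↥(maximalRealSubfield L)) L (IsCMField.complexConj L) 2 (Matrix.of fun i j : Fin 2 => if i.val + j.val + 1 = 2 then (1 : L) else 0)) ×
      ↥(arch (↥(maximalRealSubfield L)) L (IsCMField.complexConj L) 1 (Matrix.of fun i j : Fin 1 => if i.val + j.val + 1 = 1 then (1 : L) else 0)) → ℂ)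
    (S : Finset {w : InfinitePlace L // IsComplex w}) {w : {w : InfinitePlace L // IsComplex w}} (hw : w ∉ S) (c : {w : InfinitePlace L // IsComplex w} → Fin 3 → ℝ) :
    stOrbFamH L νH fH S (flipAt w c) * archRH S c = archRH S (flipAt w c) * stOrbFamH L νH fH S c :=
  bzExtend_normStableSum_flipAt_mul_archRH S (chartOrbH L νH S fH) hw c

/-- **(W), REAL HALF** from the realised-reflection invariance of the chart functional: if `chartOrbH νH S fH (negXAt w c) = chartOrbH νH S fH c` for `w ∈ S`, `c ∈ RegS S` (conjugation
by the Weyl element of `U(Φ₂)_w` normalising the split torus — (T-MEAS) `chartOrbH_negXAt`), then `stOrbFamH S (negXAt w c) = stOrbFamH S c` for EVERY `c`.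
[cite: Shelstad1979, §4 p. 23] -/
theorem stOrbFamH_negXAt
    (fH : ↥(arch (↥(maximalRealSubfield L)) L (IsCMField.complexConj L) 2 (Matrix.of fun i j : Fin 2 => if i.val + j.val + 1 = 2 then (1 : L) else 0)) ×
      ↥(arch (↥(maximalRealSubfield L)) L (IsCMField.complexConj L) 1 (Matrix.of fun i j : Fin 1 => if i.val + j.val + 1 = 1 then (1 : L) else 0)) → ℂ)
    (S : Finset {w : InfinitePlace L // IsComplex w}) {w : {w : InfinitePlace L // IsComplex w}} (hw : w ∈ S)
    (hneg : ∀ c ∈ RegS S, chartOrbH L νH S fH (negXAt w c) = chartOrbH L νH S fH c) (c : {w : InfinitePlace L // IsComplex w} → Fin 3 → ℝ) :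
    stOrbFamH L νH fH S (negXAt w c) = stOrbFamH L νH fH S c :=
  bzExtend_normStableSum_negXAt S hw hneg c

/-- **(W) FOR THE STABLE ORBITAL FAMILY**: `ArchBzWeyl (stOrbFamH L νH fH)` given the realised-reflection invariance of the chart functionals on the regular sets
(`hneg`; the flip half is unconditional). [cite: Shelstad1979, §4 p. 23] [cite: Bouaziz1994IntegralesOrbitales, §6.2 p. 591] -/
theorem archBzWeyl_stOrbFamH
    (fH : ↥(arch (↥(maximalRealSubfield L)) L (IsCMField.complexConj L) 2 (Matrix.of fun i j : Fin 2 => if i.val + j.val + 1 = 2 then (1 : L) else 0)) ×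
      ↥(arch (↥(maximalRealSubfield L)) L (IsCMField.complexConj L) 1 (Matrix.of fun i j : Fin 1 => if i.val + j.val + 1 = 1 then (1 : L) else 0)) → ℂ)
    (hneg : ∀ (S : Finset {w : InfinitePlace L // IsComplex w}) (w : {w : InfinitePlace L // IsComplex w}), w ∈ S →
      ∀ c ∈ RegS S, chartOrbH L νH S fH (negXAt w c) = chartOrbH L νH S fH c) :
    ArchBzWeyl (stOrbFamH L νH fH) :=
  ⟨fun S c _ hw => stOrbFamH_flipAt_mul_archRH L νH fH S hw c, fun S c w hw => stOrbFamH_negXAt L νH fH S hw (hneg S w hw) c⟩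

end Family

end Literature.NumberTheory.Rogawski1990

end
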